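import Summits.AtomisticToContinuum.FouriersLaw.Theses.HoelderEscapeProfile

/-!
# LocalEnergyHalfHoelder — junk-model exclusion and load-bearing hypotheses (negative-side support)

Support lemmas for crux `HoelderEscapeProfile.LocalEnergyHalfHoelder` (item stmt-AtomisticToContinuum-16008,
K1 of card guarneri-escape-profile-positivity: the Abel-mean on-site energy return
`Ψ(ν) = ν∫₀^∞ e^{-νt} Cov_μ(h_0, h_0∘φ_t) dt` obeys `Ψ(ν) ≤ C√ν` for small `ν`), from the refuter's
crux-attack cycle (2026-08-17). All sorry-free, no new definitions.

* `gibbs_momentum_zero_null`: for ANY chain Gibbs measure `μ` (DLR for `chainSpecification P T`) the event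
  `p_0 = 0` is `μ`-null — the one-site kernel is a tilt of (the image of) Lebesgue measure on `ℝ × ℝ`,
  which does not charge the hyperplane `{p_0 = 0}`; then DLR at `Λ = {0}`.
* `no_frozen_dynamics`: the FROZEN (identity) flow — the one degenerate model on which K1's conclusion is
  plainly false (`S(0,t) ≡ Var h_0 > 0`, an atom of the site-energy spectral measure at `0`) — is NOT an
  admissible `InfiniteChainDynamics` preserving a Gibbs measure: an orbit is constant only where
  `p_0 = dq_0/dt = 0`, a null event, while `PreservesMeasure` makes the carrier conull. So the guarded
  pair `(μ, D)` of the crux (and of every FouriersLaw route sharing this prefix) admits no frozen junk.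
* `abelMean_shape_false_for_atom`: the conclusion SHAPE of K1 fails for the frozen profile `f ≡ 1`
  (`ν∫₀^∞e^{-νt}dt = 1 ≰ C√ν` as `ν ↓ 0`): the conclusion is not decoration, the dynamical hypotheses
  (`PreservesMeasure`, `isSolution`) are load-bearing, and an atom at frequency `0` is exactly what K1 forbids.
* `sqrt_bound_extend`: the `∃ ν₀` of K1 is cosmetic given any uniform bound `Ψ ≤ V`, `0 ≤ V`
  (e.g. `V = Var h_0` by Cauchy–Schwarz and measure preservation): the content of K1 is the exponent `½` at `ν ↓ 0`.
-/

noncomputable section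

open MeasureTheory Set
open Literature.MathematicalPhysics.KineticTheory.HeatConduction
open Literature.Probability.LatticeModels

namespace Summit.AtomisticToContinuum.FouriersLaw.Theorems.LocalEnergyHalfHoelder.Negative.FrozenFlowExcluded

/-- Under ANY Gibbs measure of an oscillator chain (DLR for `P.chainSpecification T`) the momentum at the
origin is almost surely non-zero: `μ {σ | p_0(σ) = 0} = 0`.  Proof: the one-site kernel
`γ_{0}(· | η)` is `Measure.tilted` of the push-forward of Lebesgue measure on `({0} → ℝ × ℝ)`, hence
absolutely continuous with respect to it, and the hyperplane `p_0 = 0` is Lebesgue-null; the DLR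
equation at `Λ = {0}` transfers this to `μ`. [folklore] -/
theorem gibbs_momentum_zero_null (P : OscillatorChain) (T : ℝ) (μ : Measure ChainConfig)
    (hG : P.IsChainGibbsMeasure T μ) : μ {σ | (σ 0).2 = 0} = 0 := by
  classical
  set A : Set ChainConfig := {σ | (σ 0).2 = 0} with hAdef
  have hA : MeasurableSet A := by
    have hm : Measurable fun σ : ChainConfig => (σ 0).2 := (measurable_pi_apply 0).snd
    exact hm (measurableSet_singleton 0)
  have hDLR := hG.2 ({0} : Finset ℤ) A hA
  have h0 : (0:ℤ) ∈ ({0} : Finset ℤ) := Finset.mem_singleton_self 0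
  have hzero : ∀ η : ChainConfig, P.chainSpecification T {0} η A = 0 := by
    intro η
    show gibbsSpecOfPotential _ _ _ _ {0} η A = 0
    unfold gibbsSpecOfPotential
    refine (tilted_absolutelyContinuous _ _) ?_
    rw [Measure.map_apply (measurable_glueWith _ η) hA]
    have hpre : (fun ζ : (↥({0} : Finset ℤ)) → ℝ × ℝ => glueWith ({0} : Finset ℤ) ζ η) ⁻¹' A
        = Function.eval (⟨0, h0⟩ : ↥({0} : Finset ℤ)) ⁻¹' (Prod.snd ⁻¹' ({0} : Set ℝ)) := by
      ext ζ
      simp [A, h0]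
    rw [hpre]
    refine Measure.pi_eval_preimage_null _ ?_
    show (volume : Measure (ℝ × ℝ)) (Prod.snd ⁻¹' ({0} : Set ℝ)) = 0
    rw [Measure.volume_eq_prod]
    exact Measure.quasiMeasurePreserving_snd.preimage_null (measure_singleton (0:ℝ))
  simp only [hzero, lintegral_zero] at hDLR
  exact hDLR.symm

/-- **No frozen dynamics.** An `InfiniteChainDynamics` whose orbits from the carrier are all constant
cannot preserve a Gibbs measure of the chain: constancy of `q_0` along an orbit forces
`p_0 = dq_0/dt = 0` on the carrier (by `isSolution` and uniqueness of derivatives), the carrier is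
`μ`-conull (`PreservesMeasure`), and `{p_0 = 0}` is `μ`-null (`gibbs_momentum_zero_null`).  This is the
junk model on which `LocalEnergyHalfHoelder`'s conclusion would be false (`S(0,t) ≡ Var h_0`), and it is
excluded by the crux's hypotheses. [folklore] -/
theorem no_frozen_dynamics (P : OscillatorChain) (T : ℝ) (μ : Measure ChainConfig)
    (hG : P.IsChainGibbsMeasure T μ) (D : InfiniteChainDynamics P) (hP : D.PreservesMeasure μ)
    (hfrozen : ∀ σ ∈ D.carrier, ∀ t, D.flow t σ = σ) : False := by
  haveI := hG.isProbabilityMeasure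
  have hsub : D.carrier ⊆ {σ | (σ 0).2 = 0} := by
    intro σ hσ
    have hsol : HasDerivAt (fun s : ℝ => (D.flow s σ 0).1) (D.flow 0 σ 0).2 0 :=
      (D.isSolution σ hσ 0 0).1
    have hconst : HasDerivAt (fun s : ℝ => (D.flow s σ 0).1) 0 0 := by
      have : (fun s : ℝ => (D.flow s σ 0).1) = fun _ => (σ 0).1 := by
        funext s; rw [hfrozen σ hσ s]
      rw [this]; exact hasDerivAt_const 0 _
    have h := hsol.unique hconst
    rw [hfrozen σ hσ 0] at h
    exact h
  have hA : MeasurableSet {σ : ChainConfig | (σ 0).2 = 0} := by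
    have hm : Measurable fun σ : ChainConfig => (σ 0).2 := (measurable_pi_apply 0).snd
    exact hm (measurableSet_singleton 0)
  have h1 : ∀ᵐ σ ∂μ, σ ∈ {σ : ChainConfig | (σ 0).2 = 0} := hP.1.mono fun σ hσ => hsub hσ
  have h2 : μ {σ : ChainConfig | (σ 0).2 = 0} = 1 := by
    rw [ae_iff] at h1
    rw [← prob_compl_eq_zero_iff hA, Set.compl_setOf]
    simpa using h1
  have h3 := gibbs_momentum_zero_null P T μ hG
  rw [h3] at h2
  exact zero_ne_one h2

/-- **The conclusion shape of `LocalEnergyHalfHoelder` is false for an atom at frequency 0.**  For the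
frozen profile `f ≡ 1` (the Laplace picture of `S(0,t) ≡ const > 0`), `ν∫₀^∞ e^{-νt} f = 1` for every
`ν > 0`, so no `C, ν₀` give `ν∫₀^∞e^{-νt}f ≤ C√ν` on `(0, ν₀]` — although the Abel integrability guard of
the crux holds.  Hence the crux's conclusion is not provable from the guard alone: the dynamical
hypotheses are load-bearing, and (via `no_frozen_dynamics`) the only cheap falsifying model is excluded. [folklore] -/
theorem abelMean_shape_false_for_atom :
    ¬ (∀ f : ℝ → ℝ, (∀ ν : ℝ, 0 < ν → IntegrableOn (fun t => Real.exp (-(ν * t)) * f t) (Ioi 0)) →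
      ∃ C ν₀ : ℝ, 0 < ν₀ ∧ ∀ ν : ℝ, 0 < ν → ν ≤ ν₀ →
        ν * ∫ t in Ioi (0:ℝ), Real.exp (-(ν * t)) * f t ≤ C * Real.sqrt ν) := by
  intro H
  obtain ⟨C, ν₀, hν₀, hC⟩ := H (fun _ => 1) (fun ν hν => by
    simpa only [mul_one, neg_mul] using exp_neg_integrableOn_Ioi 0 hν)
  have key : ∀ ν, 0 < ν → ν ≤ ν₀ → 1 ≤ C * Real.sqrt ν := by
    intro ν hν hle
    have h := hC ν hν hle
    have hint : ∫ t in Ioi (0:ℝ), Real.exp (-(ν * t)) * (1:ℝ) = 1 / ν := by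
      simp only [mul_one]
      have h2 : ∫ t in Ioi (0:ℝ), Real.exp (-ν * t) = -Real.exp (-ν * 0) / -ν :=
        integral_exp_mul_Ioi (neg_lt_zero.mpr hν) 0
      rw [mul_zero, Real.exp_zero, neg_div_neg_eq] at h2
      simpa only [neg_mul] using h2
    rw [hint] at h
    have h3 : ν * (1 / ν) = 1 := by field_simp
    linarith
  rcases le_or_gt C 0 with hC0 | hC0
  · have h1 := key ν₀ hν₀ le_rfl
    nlinarith [Real.sqrt_nonneg ν₀]
  · set ν := min ν₀ (1 / (4 * C ^ 2)) with hν
    have hνpos : 0 < ν := lt_min hν₀ (by positivity)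
    have h1 := key ν hνpos (min_le_left _ _)
    have h2 : ν ≤ 1 / (4 * C ^ 2) := min_le_right _ _
    have h3 : Real.sqrt ν ≤ Real.sqrt (1 / (4 * C ^ 2)) := Real.sqrt_le_sqrt h2
    have h4 : Real.sqrt (1 / (4 * C ^ 2)) = 1 / (2 * C) := by
      rw [show (1:ℝ) / (4 * C ^ 2) = (1 / (2 * C)) ^ 2 by field_simp; ring]
      exact Real.sqrt_sq (by positivity)
    rw [h4] at h3
    have h5 : C * Real.sqrt ν ≤ C * (1 / (2 * C)) := mul_le_mul_of_nonneg_left h3 hC0.le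
    have h6 : C * (1 / (2 * C)) = 1 / 2 := by field_simp
    linarith

/-- **`ν₀` is cosmetic.**  If `Ψ ≤ V` uniformly on `ν > 0` with `0 ≤ V` (for K1: `V = Var h_0`, by
Cauchy–Schwarz and measure preservation) and `Ψ ν ≤ C√ν` on `(0, ν₀]`, then `Ψ ν ≤ max C (V/√ν₀) · √ν`
for ALL `ν > 0`: the content of K1 is the exponent `½` as `ν ↓ 0`, not the threshold. [folklore] -/
theorem sqrt_bound_extend (Ψ : ℝ → ℝ) (C V ν₀ : ℝ) (hν₀ : 0 < ν₀) (hV0 : 0 ≤ V)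
    (hV : ∀ ν, 0 < ν → Ψ ν ≤ V)
    (hC : ∀ ν, 0 < ν → ν ≤ ν₀ → Ψ ν ≤ C * Real.sqrt ν) :
    ∀ ν, 0 < ν → Ψ ν ≤ max C (V / Real.sqrt ν₀) * Real.sqrt ν := by
  intro ν hν
  have hs : 0 < Real.sqrt ν := Real.sqrt_pos.mpr hν
  rcases le_or_gt ν ν₀ with h | h
  · exact (hC ν hν h).trans (mul_le_mul_of_nonneg_right (le_max_left _ _) hs.le)
  · have hs0 : 0 < Real.sqrt ν₀ := Real.sqrt_pos.mpr hν₀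
    have hmono : Real.sqrt ν₀ ≤ Real.sqrt ν := Real.sqrt_le_sqrt h.le
    have hVle : V ≤ V / Real.sqrt ν₀ * Real.sqrt ν := by
      rw [div_mul_eq_mul_div, le_div_iff₀ hs0]
      exact mul_le_mul_of_nonneg_left hmono hV0
    exact (hV ν hν).trans (hVle.trans (mul_le_mul_of_nonneg_right (le_max_right _ _) hs.le))

end Summit.AtomisticToContinuum.FouriersLaw.Theorems.LocalEnergyHalfHoelder.Negative.FrozenFlowExcluded

end
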